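import Mathlib
import HarnessLib

/-!
# THETA kernel certificate, analytic layer D6 (arithmetic half, part 1: calculus): the test weight `f(t) = (log t − log N)/t^{m+1}` (RH-FREE)

Cell `rh-explicit`, WEIL column, seat handoff-prove-2 gen12; typing lane of `ThetaCertificateSound`
(THETA-CERT-cc6 §D6 «SECOND SUM»; director I l.7328 (A)(ii): «D6 via the named RS fact»).  Nothing here bears on the
truth of RH; this file is elementary real analysis + Abel summation over Mathlib's `Chebyshev.psi`.

For `m ≥ 1`, `N > 0` and any `C ≥ 0` with **`ψ(x) ≤ C·x` for all `x ≥ 0`** (HYPOTHESIS; Rosser–Schoenfeld 1962, Thm 12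
gives `C = 1.03883`, cited by name by the arithmetic layer — NOT proved here), every finite piece of the cross sum obeys

  `Σ_{n<K} Λ(n)·max 0 (log n − log N)/n^{m+1} ≤ C·(e^{−m/(m+1)}/(m+1) + 1/m²)/N^m`

(`vonMangoldt_logTail_sum_le`, in the sequel `WeilColumnThetaPrimeTail`) — the hypothesis `hS₂` of `WeilColumnThetaPrimeSide.norm_weilPrimeTerm_le_of_oddTail` with
the `cross` let of cc-s2-1's `ThetaTier1Check.check` (`2·RS·M²·(1/m² + e^{−m/(m+1)}/(m+1))` after `2E²N^{m+½}·N^{−m} = 2M²`).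
Proof = THETA-CERT §D6 verbatim: with `f(t) = (log t − log N)/t^{m+1}` (vanishing at `N`, increasing up to
`x* = Ne^{1/(m+1)}`, decreasing after), Abel summation (`sum_mul_eq_sub_sub_integral_mul`) gives
`Σ_{N<n≤b} Λ(n)f(n) = f(b)ψ(b) − ∫_N^b f′ψ ≤ C·b·f(b) + C∫_{x*}^{b} t(−f′(t))dt = C·(x*f(x*) + F(b) − F(x*))` by parts
(`F′ = f`, `F(t) = −(log t − log N + 1/m)/(m t^m) ≤ 0`), and `−F(x*) ≤ −F(N) = 1/(m²N^m)` because `e^{m/(m+1)} ≥ (2m+1)/(m+1)`.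
THIS FILE: the derivatives of `f`, `F`, `G = −t f + F`, the sign of `f′` on either side of `x*`, the near-threshold bound
`b f(b) ≤ e^{−m/(m+1)}/((m+1)N^m)` and the comparison `−F(x*) ≤ −F(N)`.
-/

noncomputable section

set_option linter.dupNamespace false

open Set MeasureTheory Filter Finset
open scoped Real Topology ArithmeticFunction.vonMangoldt Chebyshev

namespace Summit.RiemannHypothesis.RiemannHypothesis.Theorems.WeilColumn.ThetaPrime

variable {N C : ℝ} {m : ℕ}

/-! ## §1 Calculus of `f(t) = (log t − log N)/t^{m+1}`, its primitive `F` and `G = −t f + F` -/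

/-- `f′(t) = (1 − (m+1)(log t − log N))/t^{m+2}` for `t > 0`. [folklore] -/
theorem hasDerivAt_logTail {t : ℝ} (ht : 0 < t) (N : ℝ) (m : ℕ) :
    HasDerivAt (fun t : ℝ ↦ (Real.log t - Real.log N) / t ^ (m + 1))
      ((1 - ((m : ℝ) + 1) * (Real.log t - Real.log N)) / t ^ (m + 2)) t := by
  have hnum : HasDerivAt (fun t : ℝ ↦ Real.log t - Real.log N) (t⁻¹) t := by
    simpa using (Real.hasDerivAt_log ht.ne').sub_const (Real.log N)
  have hden : HasDerivAt (fun t : ℝ ↦ t ^ (m + 1)) (((m + 1 : ℕ) : ℝ) * t ^ m) t := by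
    simpa using hasDerivAt_pow (m + 1) t
  have h := hnum.div hden (pow_ne_zero _ ht.ne')
  refine h.congr_deriv ?_
  have ht0 : t ≠ 0 := ht.ne'
  push_cast
  field_simp
  ring

/-- `F′ = f` with `F(t) = −(log t − log N + 1/m)/(m t^m)` (`t > 0`, `m ≥ 1`). [folklore] -/
theorem hasDerivAt_logTailPrim (hm : 1 ≤ m) {t : ℝ} (ht : 0 < t) (N : ℝ) :
    HasDerivAt (fun t : ℝ ↦ -(Real.log t - Real.log N + 1 / m) / ((m : ℝ) * t ^ m))
      ((Real.log t - Real.log N) / t ^ (m + 1)) t := by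
  have hm0 : (m : ℝ) ≠ 0 := by exact_mod_cast (by omega : m ≠ 0)
  have hnum : HasDerivAt (fun t : ℝ ↦ -(Real.log t - Real.log N + 1 / m)) (-t⁻¹) t :=
    (((Real.hasDerivAt_log ht.ne').sub_const (Real.log N)).add_const (1 / (m : ℝ))).neg
  have hden : HasDerivAt (fun t : ℝ ↦ (m : ℝ) * t ^ m) ((m : ℝ) * ((m : ℕ) * t ^ (m - 1))) t :=
    (hasDerivAt_pow m t).const_mul _
  have h := hnum.div hden (mul_ne_zero hm0 (pow_ne_zero _ ht.ne'))
  refine h.congr_deriv ?_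
  have ht0 : t ≠ 0 := ht.ne'
  obtain ⟨k, rfl⟩ : ∃ k, m = k + 1 := ⟨m - 1, by omega⟩
  simp only [Nat.add_sub_cancel]
  push_cast
  field_simp
  ring

/-- `G′(t) = −t f′(t)` with `G(t) = −t f(t) + F(t) = −(log t − log N)/t^m + F(t)`. [folklore] -/
theorem hasDerivAt_logTailByParts (hm : 1 ≤ m) {t : ℝ} (ht : 0 < t) (N : ℝ) :
    HasDerivAt (fun t : ℝ ↦ -(Real.log t - Real.log N) / t ^ m +
        -(Real.log t - Real.log N + 1 / m) / ((m : ℝ) * t ^ m))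
      (-(t * ((1 - ((m : ℝ) + 1) * (Real.log t - Real.log N)) / t ^ (m + 2)))) t := by
  have hm0 : (m : ℝ) ≠ 0 := by exact_mod_cast (by omega : m ≠ 0)
  have h1 : HasDerivAt (fun t : ℝ ↦ -(Real.log t - Real.log N) / t ^ m)
      ((-t⁻¹ * t ^ m - -(Real.log t - Real.log N) * ((m : ℕ) * t ^ (m - 1))) / (t ^ m) ^ 2) t := by
    have hnum : HasDerivAt (fun t : ℝ ↦ -(Real.log t - Real.log N)) (-t⁻¹) t :=
      ((Real.hasDerivAt_log ht.ne').sub_const (Real.log N)).neg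
    exact hnum.div (hasDerivAt_pow m t) (pow_ne_zero _ ht.ne')
  have h := h1.add (hasDerivAt_logTailPrim hm ht N)
  refine h.congr_deriv ?_
  have ht0 : t ≠ 0 := ht.ne'
  obtain ⟨k, rfl⟩ : ∃ k, m = k + 1 := ⟨m - 1, by omega⟩
  simp only [Nat.add_sub_cancel]
  push_cast
  field_simp
  ring

/-- Sign of `f′`: nonnegative on `(0, Ne^{1/(m+1)}]`. -/
theorem logTail_deriv_nonneg (hN : 0 < N) {t : ℝ} (ht : 0 < t) (hle : t ≤ N * Real.exp (1 / ((m : ℝ) + 1))) :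
    0 ≤ (1 - ((m : ℝ) + 1) * (Real.log t - Real.log N)) / t ^ (m + 2) := by
  refine div_nonneg ?_ (by positivity)
  have hm1 : (0 : ℝ) < (m : ℝ) + 1 := by positivity
  have hlog : Real.log t - Real.log N ≤ 1 / ((m : ℝ) + 1) := by
    have := Real.log_le_log ht hle
    rw [Real.log_mul hN.ne' (Real.exp_pos _).ne', Real.log_exp] at this
    linarith
  have := mul_le_mul_of_nonneg_left hlog hm1.le
  rw [mul_one_div_cancel hm1.ne'] at this
  linarith

/-- Sign of `f′`: nonpositive on `[Ne^{1/(m+1)}, ∞)`. -/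
theorem logTail_deriv_nonpos (hN : 0 < N) {t : ℝ} (hle : N * Real.exp (1 / ((m : ℝ) + 1)) ≤ t) :
    (1 - ((m : ℝ) + 1) * (Real.log t - Real.log N)) / t ^ (m + 2) ≤ 0 := by
  have hx : 0 < N * Real.exp (1 / ((m : ℝ) + 1)) := by positivity
  have ht : 0 < t := hx.trans_le hle
  refine div_nonpos_of_nonpos_of_nonneg ?_ (by positivity)
  have hm1 : (0 : ℝ) < (m : ℝ) + 1 := by positivity
  have hlog : 1 / ((m : ℝ) + 1) ≤ Real.log t - Real.log N := by
    have := Real.log_le_log hx hle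
    rw [Real.log_mul hN.ne' (Real.exp_pos _).ne', Real.log_exp] at this
    linarith
  have := mul_le_mul_of_nonneg_left hlog hm1.le
  rw [mul_one_div_cancel hm1.ne'] at this
  linarith

/-- `s e^{−ms} ≤ s₀ e^{−ms₀}` for `0 ≤ s ≤ s₀` with `m s₀ ≤ 1` (`φ(s) = se^{−ms}` increases up to `1/m`). [folklore] -/
theorem mul_exp_neg_le_of_le {s s₀ : ℝ} {m : ℝ} (hs : 0 ≤ s) (hss : s ≤ s₀) (hs₀ : m * s₀ ≤ 1) :
    s * Real.exp (-(m * s)) ≤ s₀ * Real.exp (-(m * s₀)) := by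
  have hA : 0 < Real.exp (-(m * s)) := Real.exp_pos _
  have hkey : Real.exp (-(m * s)) * (1 - m * (s₀ - s)) ≤ Real.exp (-(m * s₀)) := by
    have h1 := Real.add_one_le_exp (-(m * (s₀ - s)))
    have h2 : Real.exp (-(m * s₀)) = Real.exp (-(m * s)) * Real.exp (-(m * (s₀ - s))) := by
      rw [← Real.exp_add]; ring_nf
    rw [h2]
    exact mul_le_mul_of_nonneg_left (by linarith) hA.le
  have hs₀0 : 0 ≤ s₀ := hs.trans hss
  have h3 : s ≤ s₀ * (1 - m * (s₀ - s)) := by nlinarith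
  calc s * Real.exp (-(m * s)) ≤ s₀ * (1 - m * (s₀ - s)) * Real.exp (-(m * s)) :=
        mul_le_mul_of_nonneg_right h3 hA.le
    _ = s₀ * (Real.exp (-(m * s)) * (1 - m * (s₀ - s))) := by ring
    _ ≤ s₀ * Real.exp (-(m * s₀)) := mul_le_mul_of_nonneg_left hkey hs₀0

/-- Near the threshold `t f(t)` is small: for `N ≤ b ≤ Ne^{1/(m+1)}`,
`b·f(b) = (log b − log N)/b^m ≤ e^{−m/(m+1)}/((m+1)N^m)`. -/
theorem mul_logTail_le_near (hN : 0 < N) {b : ℝ} (hNb : N ≤ b)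
    (hb : b ≤ N * Real.exp (1 / ((m : ℝ) + 1))) :
    b * ((Real.log b - Real.log N) / b ^ (m + 1)) ≤
      Real.exp (-((m : ℝ) / ((m : ℝ) + 1))) / (((m : ℝ) + 1) * N ^ m) := by
  have hb0 : 0 < b := hN.trans_le hNb
  set s := Real.log b - Real.log N with hs
  have hs0 : 0 ≤ s := by rw [hs]; linarith [Real.log_le_log hN hNb]
  have hm1 : (0 : ℝ) < (m : ℝ) + 1 := by positivity
  have hs1 : s ≤ 1 / ((m : ℝ) + 1) := by
    have := Real.log_le_log hb0 hb
    rw [Real.log_mul hN.ne' (Real.exp_pos _).ne', Real.log_exp] at this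
    rw [hs]; linarith
  -- `b^m = N^m e^{ms}`
  have hbm : b ^ m = N ^ m * Real.exp ((m : ℝ) * s) := by
    rw [hs, mul_sub, Real.exp_sub, ← Real.log_pow, ← Real.log_pow, Real.exp_log (pow_pos hb0 m),
      Real.exp_log (pow_pos hN m)]
    field_simp
  have hlhs : b * ((Real.log b - Real.log N) / b ^ (m + 1)) = s * Real.exp (-((m : ℝ) * s)) / N ^ m := by
    rw [← hs, pow_succ, hbm, Real.exp_neg]
    field_simp
  have hmono := mul_exp_neg_le_of_le (m := (m : ℝ)) hs0 hs1
    (by rw [mul_one_div]; exact div_le_one_of_le₀ (by linarith) hm1.le)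
  rw [hlhs, div_mul_eq_div_div]
  refine div_le_div_of_nonneg_right ?_ (pow_pos hN m).le
  calc s * Real.exp (-((m : ℝ) * s)) ≤ 1 / ((m : ℝ) + 1) * Real.exp (-((m : ℝ) * (1 / ((m : ℝ) + 1)))) := hmono
    _ = Real.exp (-((m : ℝ) / ((m : ℝ) + 1))) / ((m : ℝ) + 1) := by
        rw [mul_one_div (m : ℝ), one_div_mul_eq_div]

/-- `e^{−m/(m+1)}·(1/(m+1) + 1/m) ≤ 1/m`, i.e. `−F(x*) ≤ −F(N)` (from `e^{m/(m+1)} ≥ 1 + m/(m+1)`). -/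
theorem exp_neg_mul_le_inv (hm : 1 ≤ m) :
    Real.exp (-((m : ℝ) / ((m : ℝ) + 1))) * (1 / ((m : ℝ) + 1) + 1 / m) ≤ 1 / m := by
  have hm0 : (0 : ℝ) < m := by exact_mod_cast hm
  have hm1 : (0 : ℝ) < (m : ℝ) + 1 := by positivity
  have hx : 0 < 1 + (m : ℝ) / ((m : ℝ) + 1) := by positivity
  have h1 : Real.exp (-((m : ℝ) / ((m : ℝ) + 1))) ≤ 1 / (1 + (m : ℝ) / ((m : ℝ) + 1)) := by
    rw [Real.exp_neg, one_div]
    exact inv_anti₀ hx (by linarith [Real.add_one_le_exp ((m : ℝ) / ((m : ℝ) + 1))])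
  have h2 : 1 / (1 + (m : ℝ) / ((m : ℝ) + 1)) * (1 / ((m : ℝ) + 1) + 1 / m) = 1 / m := by
    field_simp
    ring
  calc _ ≤ 1 / (1 + (m : ℝ) / ((m : ℝ) + 1)) * (1 / ((m : ℝ) + 1) + 1 / m) :=
        mul_le_mul_of_nonneg_right h1 (by positivity)
    _ = 1 / m := h2

end Summit.RiemannHypothesis.RiemannHypothesis.Theorems.WeilColumn.ThetaPrime

end
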